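import Mathlib
import Summits.ResolutionOfSingularities.ResolutionOfSingularities.Theorems.WildQuotientsWildQuotientResolutionJordanFiveOrder
import Summits.ResolutionOfSingularities.ResolutionOfSingularities.Theorems.WildQuotientsWildQuotientResolutionLinearSmallBlocksAlgebra

/-!
# The `J₅` augmentation ideal IS the fixed-locus ideal `(x_a, x_b, x_c, x_d)`, every `p ≥ 5`

(crux stmt-ResolutionOfSingularities-15640 `WildQuotients.WildQuotientResolution`, line `Sketch`;
chain w45c NEXT RUNG R-T / RUNG V5, brick B8 `HdivD` of res-L1-w45c-lead-1's scaffold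
`JordanFive.jordanFive_hasResolution_of_bricks` (plan-1 RULING 2026-08-27T10:54:44Z: B8 = stub-3);
the `J₅` twin of stub-4's `…JordanFourCentre`. [OURS · L1 W4.5c] — NOT a statement of any
manuscript; replaces the role of no printed item.)

For the `J₅` datum `σ x_a = x_a`, `σ x_b = x_b + x_a`, `σ x_c = x_c + x_b`, `σ x_d = x_d + x_c`,
`σ x_e = x_e + x_d`, identity on the passengers:
* `smul_sub_mem_centre` — `g • r - r ∈ (x_a, x_b, x_c, x_d)` for every `g ∈ ⟨σ⟩`, every `r`;
* `exists_natCast_ne_zero_and_pow_eq` — generic: if `σ ^ p = 1` (`p = char k`), `1 ≠ g ∈ ⟨σ⟩` is `σᵐ`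
  with `m` a unit of `k`;
* `span_smul_sub_eq_centre_prime` — `⟨g • f - f : f⟩ = (x_a, x_b, x_c, x_d)` EXACTLY for `g ≠ 1`
  (`x_a` by `LinearSmallBlocks.X_mem_augIdeal_of_transvection`, then `x_b, x_c, x_d` successively
  from `g x_c - x_c`, `g x_d - x_d`, `g x_e - x_e` and `JordanFive.pow_apply_X_c/d/e`).
-/

-- single-problem summit: the doubled namespace component `ResolutionOfSingularities` is forced
set_option linter.dupNamespace false

noncomputable section

open MvPolynomial
open scoped Pointwise

namespace Summit.ResolutionOfSingularities.ResolutionOfSingularities.Theorems.WildQuotientResolution.JordanFive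

variable (k : Type) [Field k] (n : ℕ) (σ : MvPolynomial (Fin n) k ≃ₐ[k] MvPolynomial (Fin n) k)
  (a b c d e : Fin n) (hab : a ≠ b) (hac : a ≠ c) (had : a ≠ d) (hae : a ≠ e)
  (hb : σ (X b) = X b + X a) (hc : σ (X c) = X c + X b) (hd : σ (X d) = X d + X c)
  (he : σ (X e) = X e + X d)
  (hσ : ∀ i, i ≠ b → i ≠ c → i ≠ d → i ≠ e → σ (X i) = X i)

include hb hc hd he hσ in
/-- `σ xᵢ - xᵢ ∈ (x_a, x_b, x_c, x_d)` for every coordinate (it is `x_a`, `x_b`, `x_c`, `x_d` or `0`).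
[folklore] -/
theorem apply_X_sub_X_mem_centre (i : Fin n) :
    σ (X i) - X i ∈ Ideal.span ({X a, X b, X c, X d} : Set (MvPolynomial (Fin n) k)) := by
  by_cases hib : i = b
  · subst hib
    rw [hb, add_sub_cancel_left]
    exact Ideal.subset_span (Set.mem_insert _ _)
  by_cases hic : i = c
  · subst hic
    rw [hc, add_sub_cancel_left]
    exact Ideal.subset_span (Set.mem_insert_of_mem _ (Set.mem_insert _ _))
  by_cases hid : i = d
  · subst hid
    rw [hd, add_sub_cancel_left]
    exact Ideal.subset_span (Set.mem_insert_of_mem _ (Set.mem_insert_of_mem _ (Set.mem_insert _ _)))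
  by_cases hie : i = e
  · subst hie
    rw [he, add_sub_cancel_left]
    exact Ideal.subset_span (Set.mem_insert_of_mem _ (Set.mem_insert_of_mem _
      (Set.mem_insert_of_mem _ (Set.mem_singleton _))))
  · rw [hσ i hib hic hid hie, sub_self]
    exact Ideal.zero_mem _

include hb hc hd he hσ in
/-- **`g • r ≡ r` modulo `(x_a, x_b, x_c, x_d)`** for every `g ∈ ⟨σ⟩` and every `r ∈ k[x]`
(generators, multiplicativity, `σ⁻¹`, integer powers). [folklore] -/
theorem smul_sub_mem_centre (g : Subgroup.zpowers σ) (r : MvPolynomial (Fin n) k) :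
    g • r - r ∈ Ideal.span ({X a, X b, X c, X d} : Set (MvPolynomial (Fin n) k)) := by
  classical
  set I : Ideal (MvPolynomial (Fin n) k) :=
    Ideal.span ({X a, X b, X c, X d} : Set (MvPolynomial (Fin n) k)) with hI
  obtain ⟨z, hz⟩ := Subgroup.mem_zpowers_iff.mp g.2
  have hσX : ∀ i : Fin n, σ (X i) - X i ∈ I :=
    apply_X_sub_X_mem_centre k n σ a b c d e hb hc hd he hσ
  have hσf : ∀ r : MvPolynomial (Fin n) k, σ r - r ∈ I := by
    intro r
    induction r using MvPolynomial.induction_on with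
    | C c =>
      have hc' : σ (C c) = C c := σ.commutes c
      rw [hc', sub_self]; exact Ideal.zero_mem _
    | add r r' hr hr' =>
      have : σ (r + r') - (r + r') = (σ r - r) + (σ r' - r') := by rw [map_add]; ring
      rw [this]; exact Ideal.add_mem _ hr hr'
    | mul_X r i hr =>
      have : σ (r * X i) - r * X i = (σ r - r) * σ (X i) + r * (σ (X i) - X i) := by
        rw [map_mul]; ring
      rw [this]
      exact Ideal.add_mem _ (Ideal.mul_mem_right _ _ hr) (Ideal.mul_mem_left _ _ (hσX i))
  have hσinvf : ∀ r : MvPolynomial (Fin n) k, σ⁻¹ r - r ∈ I := by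
    intro r
    have h := hσf (σ⁻¹ r)
    have e' : σ (σ⁻¹ r) = r := by rw [← AlgEquiv.mul_apply, mul_inv_cancel, AlgEquiv.one_apply]
    rw [e'] at h
    have : σ⁻¹ r - r = -(r - σ⁻¹ r) := by ring
    rw [this]
    exact neg_mem h
  have hzpow : ∀ (z : ℤ) (r : MvPolynomial (Fin n) k), (σ ^ z) r - r ∈ I := by
    intro z
    induction z using Int.induction_on with
    | zero => intro r; rw [zpow_zero, AlgEquiv.one_apply, sub_self]; exact Ideal.zero_mem _
    | succ m ih =>
      intro r
      rw [zpow_add_one, AlgEquiv.mul_apply]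
      have e' : (σ ^ (m : ℤ)) (σ r) - r = ((σ ^ (m : ℤ)) (σ r) - σ r) + (σ r - r) := by ring
      rw [e']
      exact Ideal.add_mem _ (ih (σ r)) (hσf r)
    | pred m ih =>
      intro r
      rw [zpow_sub_one, AlgEquiv.mul_apply]
      have e' : (σ ^ (-(m : ℤ))) (σ⁻¹ r) - r =
          ((σ ^ (-(m : ℤ))) (σ⁻¹ r) - σ⁻¹ r) + (σ⁻¹ r - r) := by ring
      rw [e']
      exact Ideal.add_mem _ (ih (σ⁻¹ r)) (hσinvf r)
  change (g : MvPolynomial (Fin n) k ≃ₐ[k] MvPolynomial (Fin n) k) r - r ∈ I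
  rw [← hz]
  exact hzpow z r

/-- **Exponent-`p` cyclic groups, generic**: if `σ ^ p = 1` with `p = char k` prime, every
`1 ≠ g ∈ ⟨σ⟩` is `σᵐ` with `m` a unit of `k`. (Stated for an arbitrary `k`-algebra automorphism
`σ` of `k[x₁,…,xₙ]`; the `J₃/J₄` files prove their block-specific instances.) [folklore] -/
theorem exists_natCast_ne_zero_and_pow_eq (p : ℕ) (hp : p.Prime) [CharP k p] (hσp : σ ^ p = 1)
    (g : Subgroup.zpowers σ) (hg : g ≠ 1) :
    ∃ m : ℕ, (m : k) ≠ 0 ∧ σ ^ m = (g : MvPolynomial (Fin n) k ≃ₐ[k] MvPolynomial (Fin n) k) := by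
  have hfin : IsOfFinOrder σ := isOfFinOrder_iff_pow_eq_one.mpr ⟨p, hp.pos, hσp⟩
  obtain ⟨m, hm⟩ : (g : MvPolynomial (Fin n) k ≃ₐ[k] MvPolynomial (Fin n) k) ∈ Submonoid.powers σ :=
    hfin.mem_powers_iff_mem_zpowers.mpr g.2
  have hm' : σ ^ m = (g : MvPolynomial (Fin n) k ≃ₐ[k] MvPolynomial (Fin n) k) := hm
  refine ⟨m, fun h => ?_, hm'⟩
  have hdvd : p ∣ m := (CharP.cast_eq_zero_iff k p m).mp h
  obtain ⟨l, rfl⟩ := hdvd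
  apply hg
  apply Subtype.ext
  change (g : MvPolynomial (Fin n) k ≃ₐ[k] MvPolynomial (Fin n) k) = 1
  rw [← hm', pow_mul, hσp, one_pow]

include hab hac had hae hb hc hd he hσ in
/-- **The `J₅` augmentation ideal is `(x_a, x_b, x_c, x_d)`, every `p ≥ 5`**: for `1 ≠ g ∈ ⟨σ⟩`,
`⟨g • f - f : f ∈ k[x]⟩ = (x_a, x_b, x_c, x_d)`. [folklore] -/
theorem span_smul_sub_eq_centre_prime (p : ℕ) (hp : p.Prime) (hp5 : 5 ≤ p) [CharP k p]
    (g : Subgroup.zpowers σ) (hg : g ≠ 1) :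
    Ideal.span (Set.range fun f : MvPolynomial (Fin n) k => g • f - f) =
      Ideal.span ({X a, X b, X c, X d} : Set (MvPolynomial (Fin n) k)) := by
  classical
  have hσp : σ ^ p = 1 := pow_prime_eq_one k n σ a b c d e hab hac had hae hb hc hd he hσ p hp hp5
  have ha : σ (X a) = X a := hσ a hab hac had hae
  set J := Ideal.span (Set.range fun f : MvPolynomial (Fin n) k => g • f - f) with hJ
  have hXa : (X a : MvPolynomial (Fin n) k) ∈ J :=
    LinearSmallBlocks.X_mem_augIdeal_of_transvection k p hp σ a b ha hb hσp g hg
  obtain ⟨m, hmk, hm'⟩ := exists_natCast_ne_zero_and_pow_eq k n σ p hp hσp g hg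
  have hCinv : ∀ y : MvPolynomial (Fin n) k, (m : MvPolynomial (Fin n) k) * y ∈ J → y ∈ J := by
    intro y hy
    have hx : y = C ((m : k)⁻¹) * ((m : MvPolynomial (Fin n) k) * y) := by
      rw [← mul_assoc, ← map_natCast (C : k →+* MvPolynomial (Fin n) k) m, ← map_mul,
        inv_mul_cancel₀ hmk, map_one, one_mul]
    rw [hx]
    exact Ideal.mul_mem_left _ _ hy
  have hXb : (X b : MvPolynomial (Fin n) k) ∈ J := by
    have hsmul : g • (X c : MvPolynomial (Fin n) k) - X c =
        (m : MvPolynomial (Fin n) k) * X b + ((m.choose 2 : ℕ) : MvPolynomial (Fin n) k) * X a := by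
      change (g : MvPolynomial (Fin n) k ≃ₐ[k] MvPolynomial (Fin n) k) (X c) - X c = _
      rw [← hm', pow_apply_X_c k n σ a b c d e hab hac had hae hb hc hσ m]
      ring
    refine hCinv _ ?_
    have e' : (m : MvPolynomial (Fin n) k) * X b =
        (g • (X c : MvPolynomial (Fin n) k) - X c) -
          ((m.choose 2 : ℕ) : MvPolynomial (Fin n) k) * X a := by
      rw [hsmul]; ring
    rw [e']
    exact Ideal.sub_mem _ (Ideal.subset_span ⟨X c, rfl⟩) (Ideal.mul_mem_left _ _ hXa)
  have hXc : (X c : MvPolynomial (Fin n) k) ∈ J := by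
    have hsmul : g • (X d : MvPolynomial (Fin n) k) - X d =
        (m : MvPolynomial (Fin n) k) * X c + ((m.choose 2 : ℕ) : MvPolynomial (Fin n) k) * X b +
          ((m.choose 3 : ℕ) : MvPolynomial (Fin n) k) * X a := by
      change (g : MvPolynomial (Fin n) k ≃ₐ[k] MvPolynomial (Fin n) k) (X d) - X d = _
      rw [← hm', pow_apply_X_d k n σ a b c d e hab hac had hae hb hc hd hσ m]
      ring
    refine hCinv _ ?_
    have e' : (m : MvPolynomial (Fin n) k) * X c =
        (g • (X d : MvPolynomial (Fin n) k) - X d) -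
          ((m.choose 2 : ℕ) : MvPolynomial (Fin n) k) * X b -
          ((m.choose 3 : ℕ) : MvPolynomial (Fin n) k) * X a := by
      rw [hsmul]; ring
    rw [e']
    exact Ideal.sub_mem _ (Ideal.sub_mem _ (Ideal.subset_span ⟨X d, rfl⟩)
      (Ideal.mul_mem_left _ _ hXb)) (Ideal.mul_mem_left _ _ hXa)
  have hXd : (X d : MvPolynomial (Fin n) k) ∈ J := by
    have hsmul : g • (X e : MvPolynomial (Fin n) k) - X e =
        (m : MvPolynomial (Fin n) k) * X d + ((m.choose 2 : ℕ) : MvPolynomial (Fin n) k) * X c +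
          ((m.choose 3 : ℕ) : MvPolynomial (Fin n) k) * X b +
          ((m.choose 4 : ℕ) : MvPolynomial (Fin n) k) * X a := by
      change (g : MvPolynomial (Fin n) k ≃ₐ[k] MvPolynomial (Fin n) k) (X e) - X e = _
      rw [← hm', pow_apply_X_e k n σ a b c d e hab hac had hae hb hc hd he hσ m]
      ring
    refine hCinv _ ?_
    have e' : (m : MvPolynomial (Fin n) k) * X d =
        (g • (X e : MvPolynomial (Fin n) k) - X e) -
          ((m.choose 2 : ℕ) : MvPolynomial (Fin n) k) * X c -
          ((m.choose 3 : ℕ) : MvPolynomial (Fin n) k) * X b -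
          ((m.choose 4 : ℕ) : MvPolynomial (Fin n) k) * X a := by
      rw [hsmul]; ring
    rw [e']
    exact Ideal.sub_mem _ (Ideal.sub_mem _ (Ideal.sub_mem _ (Ideal.subset_span ⟨X e, rfl⟩)
      (Ideal.mul_mem_left _ _ hXc)) (Ideal.mul_mem_left _ _ hXb)) (Ideal.mul_mem_left _ _ hXa)
  apply le_antisymm
  · rw [hJ]
    refine Ideal.span_le.mpr ?_
    rintro _ ⟨f, rfl⟩
    exact smul_sub_mem_centre k n σ a b c d e hb hc hd he hσ g f
  · refine Ideal.span_le.mpr ?_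
    intro x hx
    rcases hx with rfl | rfl | rfl | hx
    · exact hXa
    · exact hXb
    · exact hXc
    · rw [Set.mem_singleton_iff] at hx
      subst hx
      exact hXd

end Summit.ResolutionOfSingularities.ResolutionOfSingularities.Theorems.WildQuotientResolution.JordanFive

end
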